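import Summits.AnomalousDissipation.AnomalousDissipation.Theorems.SoloInformedSteadyReduction
import Literature.Analysis.FluidPDE.TimeAverageMeasureBasic
import Literature.Analysis.FunctionSpaces.TorusCalculusProofs
import HarnessLib

/-!
# The zeroth law as persistent force–velocity correlation (solo-informed)

For a GLOBAL CLASSICAL solution `(u, p)` of the forced Navier–Stokes system on `ℝ × T^d` whose
kinetic energy stays bounded on `[0, ∞)`, the energy equality
`½‖u(T)‖² + ν∫₀ᵀ‖∇u‖₂² = ½‖u(0)‖² + ∫₀ᵀ∫⟪f, u⟫` (Robinson–Rodrigo–Sadowski 2016, Thm. 6.5;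
in the tree `Torus.IsClassicalNSSolutionOn.energy_eq`) says that the running means of the
dissipation and of the injected power differ by `(E(0) − E(T))/T → 0`; hence the limsup long-time
means agree (Doering–Foias 2002, §2, `ε = ⟨(f, u)⟩`):

* `timeMean_dissipation_eq_of_classical` — the finite-time identity;
* `meanDissipation_eq_meanPower_of_classical` — `⟨ν‖∇u‖₂²⟩⁺ = ⟨∫⟪f, u⟫⟩⁺` for bounded
  trajectories with bounded power input;
* `anomalousDissipation_of_injectionFamily` — consequently the zeroth law
  (`AnomalousDissipation`) follows from: ONE smooth steady force `f` and a vanishing-viscosity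
  family of bounded global classical solutions whose velocity stays CORRELATED with the force,
  `⟨∫⟪f, u_j(t)⟫⟩⁺ ≥ ε > 0`, at bounded mean energy.

This isolates what any construction must achieve: not small-scale roughness per se, but an
`O(1)` lower bound, uniform in `ν → 0`, on the mean power drawn from the fixed force by some
bounded exact trajectory (steady, periodic or chaotic).  Laminar detuned states draw `O(ν)`.

References: Robinson–Rodrigo–Sadowski, *The Three-Dimensional Navier–Stokes Equations*, CUP
2016, Thm. 6.5 [RobinsonRodrigoSadowski2016]; Doering–Foias, JFM 467 (2002) §2
[DoeringFoias2002].
-/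

noncomputable section

open MeasureTheory Filter Topology Set
open scoped ENNReal NNReal InnerProductSpace RealInnerProductSpace

namespace Summit.AnomalousDissipation.AnomalousDissipation.Theorems

open Literature.Analysis.FunctionSpaces Literature.Analysis.FluidPDE

/-- The physical flat unit torus `T³ = (ℝ/ℤ)³` (local notation). -/
local notation "𝕋³" => UnitAddTorus (Fin 3)
/-- Velocity values on `T³` (local notation). -/
local notation "E³" => EuclideanSpace ℝ (Fin 3)

variable {d : Type*} [Fintype d] [DecidableEq d]

/-- **Running energy budget of a classical solution**: for `T > 0`,
`T⁻¹∫₀ᵀ ν‖∇u‖₂² = T⁻¹∫₀ᵀ∫⟪f, u⟫ + (E(0) − E(T))/T`, `E = ½‖u‖²` (the energy equality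
`Torus.IsClassicalNSSolutionOn.energy_eq` divided by `T`; Doering–Foias 2002, §2).
[cite: DoeringFoias2002, §2] -/
theorem timeMean_dissipation_eq_of_classical {ν : ℝ}
    {f u : ℝ → UnitAddTorus d → EuclideanSpace ℝ d} {p : ℝ → UnitAddTorus d → ℝ}
    (h : Torus.IsClassicalNSSolutionOn univ ν f u p) {T : ℝ} (hT : 0 < T) :
    timeMean (fun t => ν * Torus.gradNormSq (u t)) T =
      timeMean (fun t => ∫ x, ⟪f t x, u t x⟫_ℝ) T +
        T⁻¹ * (Torus.kineticEnergy (u 0) - Torus.kineticEnergy (u T)) := by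
  have hE := h.energy_eq convex_univ hT.le (subset_univ _)
  unfold timeMean
  rw [intervalIntegral.integral_const_mul]
  have hid : ν * ∫ τ in (0 : ℝ)..T, Torus.gradNormSq (u τ) =
      (∫ τ in (0 : ℝ)..T, ∫ x, ⟪f τ x, u τ x⟫_ℝ) +
        (Torus.kineticEnergy (u 0) - Torus.kineticEnergy (u T)) := by
    linarith
  rw [hid]
  ring

/-- **Mean dissipation = mean injected power** for a global classical solution whose kinetic
energy is bounded on `[0, ∞)` and whose power input is bounded on `(0, ∞)`:
`⟨ν‖∇u‖₂²⟩⁺ = ⟨∫⟪f, u⟫⟩⁺` (limsup of running means; the correction `(E(0) − E(T))/T → 0`;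
Doering–Foias 2002, §2). The spectral dissipation of the zeroth-law vocabulary is identified with
the derivative-based one by `meanDissipation_eq_of_classical`. [cite: DoeringFoias2002, §2] -/
theorem meanDissipation_eq_meanPower_of_classical {ν : ℝ}
    {f u : ℝ → UnitAddTorus (Fin 3) → EuclideanSpace ℝ (Fin 3)}
    {p : ℝ → UnitAddTorus (Fin 3) → ℝ}
    (h : Torus.IsClassicalNSSolutionOn univ ν f u p)
    (hE : ∃ M : ℝ, ∀ t, 0 ≤ t → Torus.kineticEnergy (u t) ≤ M)
    (hP : ∃ C : ℝ, ∀ t, 0 < t → |∫ x, ⟪f t x, u t x⟫_ℝ| ≤ C) :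
    meanDissipation ν u = longTimeAvgSup (fun t => ∫ x, ⟪f t x, u t x⟫_ℝ) := by
  obtain ⟨M, hM⟩ := hE
  obtain ⟨C, hC⟩ := hP
  rw [meanDissipation_eq_of_classical h]
  unfold longTimeAvgSup
  set r : ℝ → ℝ := fun T => T⁻¹ * (Torus.kineticEnergy (u 0) - Torus.kineticEnergy (u T))
    with hrdef
  have heq : timeMean (fun t => ν * Torus.gradNormSq (u t)) =ᶠ[atTop]
      fun T => timeMean (fun t => ∫ x, ⟪f t x, u t x⟫_ℝ) T + r T :=
    (eventually_gt_atTop (0 : ℝ)).mono fun T hT => timeMean_dissipation_eq_of_classical h hT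
  rw [limsup_congr heq]
  have hr : Tendsto r atTop (𝓝 0) := by
    have h1 : Tendsto (fun T : ℝ => T⁻¹ * M) atTop (𝓝 0) := by
      simpa using tendsto_inv_atTop_zero.mul_const M
    refine squeeze_zero_norm' ?_ h1
    filter_upwards [eventually_gt_atTop (0 : ℝ)] with T hT
    rw [hrdef, Real.norm_eq_abs, abs_mul, abs_of_pos (inv_pos.2 hT)]
    refine mul_le_mul_of_nonneg_left ?_ (inv_pos.2 hT).le
    have h0 := Torus.kineticEnergy_nonneg (u 0)
    have h0' := Torus.kineticEnergy_nonneg (u T)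
    have h2 := hM 0 le_rfl
    have h3 := hM T hT.le
    rw [abs_le]
    constructor <;> linarith
  exact limsup_add_eq_of_tendsto_zero hr (isBoundedUnder_le_timeMean hC)
    (isBoundedUnder_ge_timeMean hC)

omit [DecidableEq d] in
/-- The power drawn from a smooth steady force by a smooth field of kinetic energy at most `M`
is bounded: `|∫⟪f, v⟫| ≤ (sup‖f‖)·(1 + 2M)` (`‖v‖ ≤ 1 + ‖v‖²` pointwise). [folklore] -/
theorem exists_abs_power_le {f : UnitAddTorus d → EuclideanSpace ℝ d} (hf : Torus.IsSmooth f) :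
    ∃ C : ℝ, 0 ≤ C ∧ ∀ (v : UnitAddTorus d → EuclideanSpace ℝ d), Torus.IsSmooth v →
      ∀ M : ℝ, Torus.kineticEnergy v ≤ M → |∫ x, ⟪f x, v x⟫_ℝ| ≤ C * (1 + 2 * M) := by
  obtain ⟨C, hC⟩ : ∃ C, ∀ x, ‖f x‖ ≤ C := by
    obtain ⟨C, hC⟩ := (isCompact_range hf.continuous).isBounded.exists_norm_le
    exact ⟨C, fun x => hC _ (mem_range_self x)⟩
  have hC0 : 0 ≤ C := (norm_nonneg _).trans (hC 0)
  refine ⟨C, hC0, fun v hv M hM => ?_⟩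
  have hvi : Integrable (fun x => ‖v x‖ ^ 2) volume := hv.norm_sq.integrable
  have hint : Integrable (fun x => ⟪f x, v x⟫_ℝ) volume :=
    Torus.integrable_inner_of_continuous_of_memLp hf.continuous (hv.memLp 2)
  have hKE : ∫ x, ‖v x‖ ^ 2 ≤ 2 * M := by
    have : Torus.kineticEnergy v = 2⁻¹ * ∫ x, ‖v x‖ ^ 2 := rfl
    rw [this] at hM
    linarith
  have hone : ∫ x, (1 + ‖v x‖ ^ 2) ∂(volume : Measure (UnitAddTorus d)) =
      1 + ∫ x, ‖v x‖ ^ 2 := by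
    rw [integral_add (integrable_const _) hvi]
    simp
  calc |∫ x, ⟪f x, v x⟫_ℝ| = ‖∫ x, ⟪f x, v x⟫_ℝ‖ := (Real.norm_eq_abs _).symm
    _ ≤ ∫ x, ‖⟪f x, v x⟫_ℝ‖ := norm_integral_le_integral_norm _
    _ ≤ ∫ x, C * (1 + ‖v x‖ ^ 2) := by
        refine integral_mono hint.norm ((integrable_const _).add hvi |>.const_mul C) fun x => ?_
        calc ‖⟪f x, v x⟫_ℝ‖ ≤ ‖f x‖ * ‖v x‖ := norm_inner_le_norm _ _
          _ ≤ C * ‖v x‖ := by gcongr; exact hC x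
          _ ≤ C * (1 + ‖v x‖ ^ 2) := by
              refine mul_le_mul_of_nonneg_left ?_ hC0
              nlinarith [sq_nonneg (‖v x‖ - 1), norm_nonneg (v x)]
    _ = C * (1 + ∫ x, ‖v x‖ ^ 2) := by rw [integral_const_mul, hone]
    _ ≤ C * (1 + 2 * M) := by gcongr

/-- **Reduction 3 (injection families).**  One smooth, divergence-free, mean-zero steady force
`f`; viscosities `ν_j > 0`, `ν_j → 0`; global classical solutions `(u_j, p_j)` on `ℝ × T³`, each
with kinetic energy bounded on `[0, ∞)`; uniformly bounded limsup-mean energy; and velocity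
persistently CORRELATED with the force, `⟨∫⟪f, u_j(t)⟫⟩⁺ ≥ ε > 0`.  Then the zeroth law
holds: by `meanDissipation_eq_meanPower_of_classical` the mean dissipation equals the mean
injected power (Doering–Foias 2002, §2), and classical solutions are Leray–Hopf
(Robinson–Rodrigo–Sadowski 2016, Thm. 6.5). [cite: DoeringFoias2002, §2] -/
theorem anomalousDissipation_of_injectionFamily {f : 𝕋³ → E³} (hf : Torus.IsSmooth f)
    (hdiv : Torus.IsDivFree f) (hmean : Torus.HasZeroMean f)
    {ν : ℕ → ℝ} {u : ℕ → ℝ → 𝕋³ → E³} {p : ℕ → ℝ → 𝕋³ → ℝ}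
    (hν : ∀ j, 0 < ν j) (hν0 : Tendsto ν atTop (𝓝 0))
    (hsol : ∀ j, Torus.IsClassicalNSSolutionOn univ (ν j) (fun _ => f) (u j) (p j))
    (hbdd : ∀ j, ∃ M : ℝ, ∀ t, 0 ≤ t → Torus.kineticEnergy (u j t) ≤ M)
    (hE : ∃ E : ℝ, ∀ j, meanEnergy (u j) ≤ E)
    (hε : ∃ ε : ℝ, 0 < ε ∧ ∀ j, ε ≤ longTimeAvgSup (fun t => ∫ x, ⟪f x, u j t x⟫_ℝ)) :
    _root_.AnomalousDissipation := by
  obtain ⟨ε, hε, hεle⟩ := hε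
  obtain ⟨C, hC0, hC⟩ := exists_abs_power_le hf
  refine ⟨f, hf, hdiv, hmean, ν, fun j => u j 0, u, hν, hν0, fun j => (hsol j).isGlobalLerayHopf,
    hE, ε, hε, fun j => ?_⟩
  obtain ⟨M, hM⟩ := hbdd j
  have hP : ∃ C' : ℝ, ∀ t, 0 < t → |∫ x, ⟪f x, u j t x⟫_ℝ| ≤ C' :=
    ⟨C * (1 + 2 * M), fun t ht =>
      hC (u j t) ((hsol j).smooth_velocity.isSmooth_slice (mem_univ t)) M (hM t ht.le)⟩
  rw [meanDissipation_eq_meanPower_of_classical (hsol j) ⟨M, hM⟩ hP]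
  exact hεle j

/-- **Steady states: dissipation = injected power exactly.**  For a smooth steady state `(U, P)`
of the Navier–Stokes system with viscosity `ν` and steady force `f` (a time-independent classical
solution on `ℝ × T^d`), `ν‖∇U‖₂² = ∫⟪f, U⟫` (the running budget
`timeMean_dissipation_eq_of_classical` at `T = 1`, the energy being constant; Doering–Foias
2002, §2). [cite: DoeringFoias2002, §2] -/
theorem steady_dissipation_eq_power {ν : ℝ} {f U : UnitAddTorus d → EuclideanSpace ℝ d}
    {P : UnitAddTorus d → ℝ}
    (h : Torus.IsClassicalNSSolutionOn univ ν (fun _ => f) (fun _ => U) (fun _ => P)) :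
    ν * Torus.gradNormSq U = ∫ x, ⟪f x, U x⟫_ℝ := by
  have h1 := timeMean_dissipation_eq_of_classical h one_pos
  rwa [timeMean_const one_pos, timeMean_const one_pos, sub_self, mul_zero, add_zero] at h1

/-- **Reduction 4 (steady injection families).**  One smooth, divergence-free, mean-zero steady
force `f`; viscosities `ν_j > 0`, `ν_j → 0`; smooth steady states `(U_j, P_j)` of `NS_{ν_j} + f`
with `∫‖U_j‖² ≤ E` which stay CORRELATED with the force, `∫⟪f, U_j⟫ ≥ ε > 0`.  Then the zeroth
law holds (`steady_dissipation_eq_power` and `anomalousDissipation_of_steadyFamily`).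
[cite: DoeringFoias2002, §2] -/
theorem anomalousDissipation_of_steadyInjectionFamily {f : 𝕋³ → E³} (hf : Torus.IsSmooth f)
    (hdiv : Torus.IsDivFree f) (hmean : Torus.HasZeroMean f)
    {ν : ℕ → ℝ} {U : ℕ → 𝕋³ → E³} {P : ℕ → 𝕋³ → ℝ}
    (hν : ∀ j, 0 < ν j) (hν0 : Tendsto ν atTop (𝓝 0))
    (hsol : ∀ j, Torus.IsClassicalNSSolutionOn univ (ν j) (fun _ => f) (fun _ => U j) (fun _ => P j))
    (hE : ∃ E : ℝ, ∀ j, ∫ x, ‖U j x‖ ^ 2 ≤ E)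
    (hε : ∃ ε : ℝ, 0 < ε ∧ ∀ j, ε ≤ ∫ x, ⟪f x, U j x⟫_ℝ) :
    _root_.AnomalousDissipation := by
  obtain ⟨ε, hε, hεle⟩ := hε
  refine anomalousDissipation_of_steadyFamily hf hdiv hmean hν hν0 hsol hE ⟨ε, hε, fun j => ?_⟩
  rw [steady_dissipation_eq_power (hsol j)]
  exact hεle j

end Summit.AnomalousDissipation.AnomalousDissipation.Theorems

end
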